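import Mathlib
import Summits.ValiantsHypothesis.ValiantsHypothesis.Theorems.LacunarySymmetroidMatrixDescartesInertiaOneType
import Summits.ValiantsHypothesis.ValiantsHypothesis.Theorems.LacunarySymmetroidMatrixDescartesMonotoneIncoherence

/-!
# `MatrixDescartes` (stmt-ValiantsHypothesis-18050) — THE TWO-SIDED LOEWNER RUNG: PSD letters above and NSD letters below an
# ARBITRARY real symmetric pivot letter ⇒ every positive root of `det` is of positive type, hence `Z₊ ≤ m` WITH
# MULTIPLICITY — no invertibility, every size, every `K`, all exponents

HONEST FRAMING.  Cell `pub-symmetroid`, seat `val-sym-mdr-p2` (gen 21); helper file `--supports` the crux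
`Theses.LacunarySymmetroid.MatrixDescartes` (OPEN), NO closure claim; companion of the tree's first rung
`firstRung_oneSided` (PSD letters on ONE side of an arbitrary pivot, distinct zeros `≤ m`), of the one-type law
`Inertia.card_posRoots_multiset_le_of_posType` and of `GramDual.posType_of_monotone` (which needs `det S_{l₀} ≠ 0`).  A
SECTOR law in the crux's own currency; nothing here bears on the crux in its window, `stub_twoSided`, `DoorA26` / `DoorA34`,
registers, or `VP ≠ VNP`.

THE SECTOR (monotone pencils).  Real symmetric letters `S_l`, a pivot index `l₀` with `S_{l₀}` ARBITRARY (possibly singular);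
every other letter is PSD with `d_l > d_{l₀}` or NSD with `d_l < d_{l₀}`, so that `x^{−d_{l₀}}F(x)` is Loewner non-decreasing.

* **`posType_of_monotone_pencil`.**  If `det(Σ_l X^{d_l}S_l) ≢ 0` then every positive root is of POSITIVE TYPE: for a non-zero
  kernel vector `u` of `F(t)`, `t·P_u′(t) = Σ_l (d_l − d_{l₀}) t^{d_l} uᵀS_lu > 0`.  Each term is `≥ 0`; if all vanish then
  `S_lu = 0` for every `l ≠ l₀` (semidefiniteness), so `F(t)u = t^{d_{l₀}}S_{l₀}u = 0` gives `S_{l₀}u = 0`, `u` is a common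
  kernel vector of ALL letters, and `det F ≡ 0`.
* **`monotone_pencil_card_posRoots_multiset_le_size` (THE TWO-SIDED LOEWNER RUNG).**  On the sector the positive zeros of
  `det(Σ_l X^{d_l}S_l)` counted WITH MULTIPLICITY number at most `m` (the one-type law); `…_card_posRoots_le_size` for distinct
  zeros.  With `det S_{l₀} ≠ 0` the count is EXACTLY `ν([S_kS_{l₀}⁻¹S_l]_{upper}) + π([S_kS_{l₀}⁻¹S_l]_{lower})`
  (`…MonotoneExactPencil`); here nothing is inverted.  The rung is the two-sided union of the tree's first rung (all PSD
  letters above, or — after `F ↦ −F` — all below) and is tight (`X·I − diag(1,…,m)` already).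
* `monotone_pencil_card_posRoots_multiset_eq_window` — exact form: for non-singular scales `a < b` enclosing all positive
  roots, `Z₊(mult) = ν(F(a)) − ν(F(b))`.

[folklore] (Loewner monotonicity; Sylvester's law along a monotone family).  Axioms `propext`, `Classical.choice`,
`Quot.sound`.  No definitions.
-/

-- layout Summits/ValiantsHypothesis/ValiantsHypothesis forces the duplicated namespace component
set_option linter.dupNamespace false

namespace Summit.ValiantsHypothesis.ValiantsHypothesis.Theorems.LacunarySymmetroidMatrixDescartes

open Polynomial Matrix Finset
open scoped BigOperators

namespace GramDual

section TwoSidedLoewner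

variable {ι κ : Type} [Fintype ι] [DecidableEq ι] [Fintype κ] [DecidableEq κ]

omit [DecidableEq ι] in
/-- A PSD real matrix with vanishing form at `u` kills `u`. [folklore] -/
theorem mulVec_eq_zero_of_form_eq_zero {A : Matrix ι ι ℝ} (hA : A.PosSemidef) (u : ι → ℝ)
    (h : u ⬝ᵥ (A *ᵥ u) = 0) : A *ᵥ u = 0 := by
  have h' : star u ⬝ᵥ (A *ᵥ u) = 0 := by simpa only [star_trivial] using h
  exact hA.dotProduct_mulVec_zero_iff u |>.1 h'

/-- **Monotone pencils have positive-type roots (no invertibility).**  Real symmetric letters, `S_{l₀}` arbitrary, every other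
letter PSD above `d_{l₀}` or NSD below it, `det(Σ_l X^{d_l}S_l) ≢ 0`: at every positive root every non-zero kernel vector has
`P_u′(t) > 0`. [folklore] -/
theorem posType_of_monotone_pencil (d : κ → ℕ) (S : κ → Matrix ι ι ℝ) (l₀ : κ)
    (hmono : ∀ l, l ≠ l₀ → ((S l).PosSemidef ∧ d l₀ < d l) ∨ ((-(S l)).PosSemidef ∧ d l < d l₀))
    (hdet : Matrix.det (∑ l, ((Polynomial.X : Polynomial ℝ) ^ d l) • (S l).map Polynomial.C) ≠ 0) :
    ∀ t : ℝ, 0 < t → (∑ l, t ^ d l • S l).det = 0 → ∀ u : ι → ℝ, (∑ l, t ^ d l • S l) *ᵥ u = 0 → u ≠ 0 →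
      0 < (derivative (∑ l, Polynomial.C (u ⬝ᵥ (S l *ᵥ u)) * (Polynomial.X : Polynomial ℝ) ^ d l)).eval t := by
  classical
  intro t ht _ u hu hu0
  -- kernel relation and the shifted derivative
  have hker : ∑ l, t ^ d l * (u ⬝ᵥ (S l *ᵥ u)) = 0 := by
    have h := congrArg (fun w => u ⬝ᵥ w) hu
    simp only [Matrix.sum_mulVec, dotProduct_sum, Matrix.smul_mulVec, dotProduct_smul, smul_eq_mul,
      dotProduct_zero] at h
    exact h
  have hderiv := eval_derivative_rayleigh (fun l => u ⬝ᵥ (S l *ᵥ u)) d t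
  have hshift : ∑ l, ((d l : ℕ) : ℝ) * (u ⬝ᵥ (S l *ᵥ u)) * t ^ d l
      = ∑ l, (((d l : ℕ) : ℝ) - d l₀) * (u ⬝ᵥ (S l *ᵥ u)) * t ^ d l := by
    have h2 : ∑ l, ((d l₀ : ℕ) : ℝ) * (u ⬝ᵥ (S l *ᵥ u)) * t ^ d l = 0 := by
      have h3 : ∑ l, ((d l₀ : ℕ) : ℝ) * (u ⬝ᵥ (S l *ᵥ u)) * t ^ d l = (d l₀ : ℝ) * ∑ l, t ^ d l * (u ⬝ᵥ (S l *ᵥ u)) := by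
        rw [Finset.mul_sum]
        exact Finset.sum_congr rfl fun l _ => by ring
      rw [h3, hker, mul_zero]
    rw [← sub_zero (∑ l, ((d l : ℕ) : ℝ) * (u ⬝ᵥ (S l *ᵥ u)) * t ^ d l), ← h2, ← Finset.sum_sub_distrib]
    exact Finset.sum_congr rfl fun l _ => by ring
  -- each term is `≥ 0`
  have hterm : ∀ l, 0 ≤ (((d l : ℕ) : ℝ) - d l₀) * (u ⬝ᵥ (S l *ᵥ u)) * t ^ d l := by
    intro l
    by_cases hl : l = l₀
    · subst hl; simp
    rcases hmono l hl with ⟨hpsd, hdl⟩ | ⟨hnsd, hdl⟩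
    · have h1 : 0 ≤ u ⬝ᵥ (S l *ᵥ u) := by simpa only [star_trivial] using hpsd.dotProduct_mulVec_nonneg u
      exact mul_nonneg (mul_nonneg (sub_nonneg.2 (by exact_mod_cast hdl.le)) h1) (pow_pos ht _).le
    · have h1 : u ⬝ᵥ (S l *ᵥ u) ≤ 0 := by
        have h := hnsd.dotProduct_mulVec_nonneg u
        simp only [star_trivial, Matrix.neg_mulVec, dotProduct_neg] at h
        linarith
      exact mul_nonneg (mul_nonneg_of_nonpos_of_nonpos (sub_nonpos.2 (by exact_mod_cast hdl.le)) h1) (pow_pos ht _).le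
  -- not all terms vanish: otherwise `u` is a common kernel vector and `det ≡ 0`
  have hex : ∃ l, 0 < (((d l : ℕ) : ℝ) - d l₀) * (u ⬝ᵥ (S l *ᵥ u)) * t ^ d l := by
    by_contra hnone
    push Not at hnone
    have hzero : ∀ l, l ≠ l₀ → S l *ᵥ u = 0 := by
      intro l hl
      have hle := hnone l
      have heq : (((d l : ℕ) : ℝ) - d l₀) * (u ⬝ᵥ (S l *ᵥ u)) * t ^ d l = 0 := le_antisymm hle (hterm l)
      have htp : t ^ d l ≠ 0 := pow_ne_zero _ ht.ne'
      rcases hmono l hl with ⟨hpsd, hdl⟩ | ⟨hnsd, hdl⟩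
      · have hc : (((d l : ℕ) : ℝ) - d l₀) ≠ 0 := (sub_pos.2 (by exact_mod_cast hdl)).ne'
        have hf : u ⬝ᵥ (S l *ᵥ u) = 0 := by
          rcases mul_eq_zero.1 heq with h | h
          · exact (mul_eq_zero.1 h).resolve_left hc
          · exact absurd h htp
        exact mulVec_eq_zero_of_form_eq_zero hpsd u hf
      · have hc : (((d l : ℕ) : ℝ) - d l₀) ≠ 0 := (sub_neg.2 (by exact_mod_cast hdl)).ne
        have hf : u ⬝ᵥ (S l *ᵥ u) = 0 := by
          rcases mul_eq_zero.1 heq with h | h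
          · exact (mul_eq_zero.1 h).resolve_left hc
          · exact absurd h htp
        have hf' : u ⬝ᵥ ((-(S l)) *ᵥ u) = 0 := by rw [Matrix.neg_mulVec, dotProduct_neg, hf, neg_zero]
        have h := mulVec_eq_zero_of_form_eq_zero hnsd u hf'
        rwa [Matrix.neg_mulVec, neg_eq_zero] at h
    -- `S_{l₀} u = 0` from the kernel relation
    have hS₀ : S l₀ *ᵥ u = 0 := by
      have h := hu
      rw [Matrix.sum_mulVec, Finset.sum_eq_single l₀ (fun l _ hl => by rw [Matrix.smul_mulVec, hzero l hl, smul_zero])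
        (fun h => absurd (Finset.mem_univ _) h), Matrix.smul_mulVec] at h
      rcases smul_eq_zero.1 h with h | h
      · exact absurd h (pow_ne_zero _ ht.ne')
      · exact h
    have hall : ∀ l, S l *ᵥ u = 0 := fun l => by
      by_cases hl : l = l₀
      · subst hl; exact hS₀
      · exact hzero l hl
    -- hence `F(s) u = 0` for every `s`, so `det F(s) = 0` for every `s`: infinitely many roots
    apply hdet
    apply Polynomial.eq_zero_of_infinite_isRoot
    have hroot : ∀ s : ℝ, (Matrix.det (∑ l, ((Polynomial.X : Polynomial ℝ) ^ d l) • (S l).map Polynomial.C)).IsRoot s := by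
      intro s
      rw [Polynomial.IsRoot.def, DefiniteMoments.eval_det_pencil]
      have hFu : (∑ l, s ^ d l • S l) *ᵥ u = 0 := by
        rw [Matrix.sum_mulVec]
        exact Finset.sum_eq_zero fun l _ => by rw [Matrix.smul_mulVec, hall l, smul_zero]
      by_contra hne
      exact hu0 (Matrix.eq_zero_of_mulVec_eq_zero hne hFu)
    exact Set.infinite_of_injective_forall_mem (f := fun s : ℝ => s) (fun a b h => h) fun s => hroot s
  obtain ⟨l₁, hl₁⟩ := hex
  have hsum : 0 < ∑ l, (((d l : ℕ) : ℝ) - d l₀) * (u ⬝ᵥ (S l *ᵥ u)) * t ^ d l :=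
    lt_of_lt_of_le hl₁ (Finset.single_le_sum (fun l _ => hterm l) (Finset.mem_univ l₁))
  rw [← hshift, ← hderiv] at hsum
  exact pos_of_mul_pos_right hsum ht.le

/-- **THE TWO-SIDED LOEWNER RUNG.**  Real symmetric letters, `S_{l₀}` ARBITRARY, every other letter PSD with `d_l > d_{l₀}` or
NSD with `d_l < d_{l₀}`: the positive zeros of `det(Σ_l X^{d_l}S_l)` counted WITH MULTIPLICITY number at most `m = card ι`.
[folklore] -/
theorem monotone_pencil_card_posRoots_multiset_le_size (d : κ → ℕ) (S : κ → Matrix ι ι ℝ) (hS : ∀ l, (S l).IsSymm)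
    (l₀ : κ) (hmono : ∀ l, l ≠ l₀ → ((S l).PosSemidef ∧ d l₀ < d l) ∨ ((-(S l)).PosSemidef ∧ d l < d l₀)) :
    Multiset.card ((Matrix.det (∑ l, ((Polynomial.X : Polynomial ℝ) ^ d l) • (S l).map Polynomial.C)).roots.filter
        (fun t => 0 < t)) ≤ Fintype.card ι := by
  classical
  by_cases hdet : Matrix.det (∑ l, ((Polynomial.X : Polynomial ℝ) ^ d l) • (S l).map Polynomial.C) = 0
  · rw [hdet, Polynomial.roots_zero, Multiset.filter_zero, Multiset.card_zero]
    exact Nat.zero_le _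
  exact Inertia.card_posRoots_multiset_le_of_posType d S hS (posType_of_monotone_pencil d S l₀ hmono hdet)

/-- **The two-sided Loewner rung, distinct zeros**: `Z₊ ≤ m`. [folklore] -/
theorem monotone_pencil_card_posRoots_le_size (d : κ → ℕ) (S : κ → Matrix ι ι ℝ) (hS : ∀ l, (S l).IsSymm)
    (l₀ : κ) (hmono : ∀ l, l ≠ l₀ → ((S l).PosSemidef ∧ d l₀ < d l) ∨ ((-(S l)).PosSemidef ∧ d l < d l₀)) :
    ((Matrix.det (∑ l, ((Polynomial.X : Polynomial ℝ) ^ d l) • (S l).map Polynomial.C)).roots.toFinset.filter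
        (fun t => 0 < t)).card ≤ Fintype.card ι := by
  classical
  refine le_trans ?_ (monotone_pencil_card_posRoots_multiset_le_size d S hS l₀ hmono)
  rw [← Multiset.toFinset_filter]
  exact Multiset.toFinset_card_le _

/-- **Exact window form**: for non-singular scales `0 < a < b` with every positive root in `(a, b)`, the positive roots counted
with multiplicity number exactly `ν(F(a)) − ν(F(b))`. [folklore] -/
theorem monotone_pencil_card_posRoots_multiset_eq_window (d : κ → ℕ) (S : κ → Matrix ι ι ℝ) (hS : ∀ l, (S l).IsSymm)
    (l₀ : κ) (hmono : ∀ l, l ≠ l₀ → ((S l).PosSemidef ∧ d l₀ < d l) ∨ ((-(S l)).PosSemidef ∧ d l < d l₀))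
    {a b : ℝ} (ha0 : 0 < a) (hab : a < b) (ha : (∑ l, a ^ d l • S l).det ≠ 0) (hb : (∑ l, b ^ d l • S l).det ≠ 0)
    (hwin : ∀ t ∈ (Matrix.det (∑ l, ((Polynomial.X : Polynomial ℝ) ^ d l) • (S l).map Polynomial.C)).roots,
      0 < t → a < t ∧ t < b) :
    Multiset.card ((Matrix.det (∑ l, ((Polynomial.X : Polynomial ℝ) ^ d l) • (S l).map Polynomial.C)).roots.filter
        (fun t => 0 < t)) + Fintype.card {j // (Inertia.isHermitian_pencil d S hS b).eigenvalues j < 0}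
      = Fintype.card {j // (Inertia.isHermitian_pencil d S hS a).eigenvalues j < 0} := by
  classical
  have hdet : Matrix.det (∑ l, ((Polynomial.X : Polynomial ℝ) ^ d l) • (S l).map Polynomial.C) ≠ 0 := by
    intro h0
    apply ha
    rw [← DefiniteMoments.eval_det_pencil, h0, Polynomial.eval_zero]
  have hpos := posType_of_monotone_pencil d S l₀ hmono hdet
  have hwinlaw := (Inertia.card_roots_Ioo_add_negIndex_eq_of_posType d S hS hab ha hb
    (fun t hat _ hdt u hu hu0 => hpos t (lt_trans ha0 hat) hdt u hu hu0)).1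
  have hfilter : (Matrix.det (∑ l, ((Polynomial.X : Polynomial ℝ) ^ d l) • (S l).map Polynomial.C)).roots.filter
        (fun t => 0 < t)
      = (Matrix.det (∑ l, ((Polynomial.X : Polynomial ℝ) ^ d l) • (S l).map Polynomial.C)).roots.filter
        (fun t => a < t ∧ t < b) :=
    Multiset.filter_congr fun t ht => ⟨fun h => hwin t ht h, fun h => lt_trans ha0 h.1⟩
  rw [hfilter]
  exact hwinlaw

end TwoSidedLoewner

end GramDual

end Summit.ValiantsHypothesis.ValiantsHypothesis.Theorems.LacunarySymmetroidMatrixDescartes
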